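import Literature.NumberTheory.Automorphic.OrbitalIntegralFixedPointsPerPeriod   -- ★ p842666 (N1): `O_γ(1_K) = ν(K) · Σ_{q fixed} [C₀ : C ∩ q.out⁻¹ K q.out]`
import HarnessLib

/-!
# The unit orbital integral at a NON-compact centraliser, intrinsic form: `O_γ(1_K) = ν(K) · #(Fix_γ(G ⧸ K) ∕ A)` for a period lattice `A`
# (`C_G(γ) = A · C₀`, `A ∩ C₀ = 1`, `C₀` the compact core) — «the number of `γ`-fixed points of `G ⧸ K` PER PERIOD»
(Laumon (1996), Lemma (5.3.2); Kottwitz, *Tamagawa numbers* (1988), §2 — at a non-elliptic `γ` the Euler–Poincaré orbital integral is «vertices − edges per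
period of the split torus on its fixed tube»; Rogawski (1990), §4.9 p. 54, §4.3 p. 43)

Topic `NumberTheory/Automorphic`; namespace `Literature.NumberTheory.Automorphic`.  THEOREMS ONLY (no definition, no instance, no notation, no named fact,
no `sorry`).  Cell `pub/hodgecm-mathlib`, F0∕P3a, crux H413 = stmt-HodgeConjecture-24833, line «N6nsGerm» residual `stub_N6nsR2EP`, (R2) EP road RAMIFIED half,
census `F0/P3a/A-p06/g27/CENSUS-R2ram-RamifiedEulerPoincare.A-p06g27.md` §4 (N1b) (LEAD F0P3a-plan (g10) T9-6 (2); co-hand A-p17 (g22); seat A-p06 (g27)).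
HONEST LABEL: HC_CM is proved only modulo the printed citations until rung 0 closes; nothing printed is asserted — this file removes the representatives `q.out`
from ★ (N1) `orbitalIntegral_indicator_quotientMeasure_eq_mul_sum_relIndex` and states the count INTRINSICALLY.

THE MATHEMATICS (pure group theory, then the measure dress).  `G` a group, `K ≤ G`, `γ ∈ G`, `C = C_G(γ)`, `C₀, A ≤ C` subgroups with `C = A · C₀` (every
`c = a c₀`) and `A ∩ C₀ = 1`, and `S_x := C ∩ x⁻¹ K x ≤ C₀` for every `x` (all stabilisers are «compact»).  `C` acts on the `γ`-fixed points `Fix = Fix_γ(G ⧸ K)`;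
the `C`-orbits on `Fix` are indexed by the double cosets `q = K x C` with `x γ x⁻¹ ∈ K` (`q ↦ C · x⁻¹K`), and inside the `C`-orbit of `z = x⁻¹K` the map
`(a, c₀ S_x) ↦ a c₀ · z` is a BIJECTION `A × C₀ ∕ S_x ≃ C · z` (injective because `A ∩ C₀ = 1` and `S_x ≤ C₀`).  Hence
**`Fix_γ(G ⧸ K) ≃ Σ_{q fixed} A × C₀ ∕ S_{q.out}`** `A`-equivariantly, and the number of `A`-orbits of fixed points is **`#(Fix ∕ A) = Σ_{q fixed} [C₀ : S_{q.out}]`** —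
exactly the sum of ★ (N1).  With ★ (N1): **`O_γ^{ν∕t}(1_K) = ν(K) · #(Fix_γ(G ⧸ K) ∕ A)`** for `K` compact open, the class of `γ` closed, `C₀` compact open ⊇ compact core,
`t(C₀) = 1`; e.g. `C = L_w^× = ϖ^ℤ × 𝒪_w^×`, `A = ϖ^ℤ`: the fixed vertices of the building counted once per translation period of the split torus — the currency in
which Kottwitz's non-elliptic relation «vertices − edges = 0 per period» (★ p842588 `RankOneEulerPoincareGlue`, binder `hN`) is a COUNT.  `#(Fix ∕ A)` is typed
choice-free as `Nat.card (Quotient ((MulAction.orbitRel ↥A (G ⧸ K)).comap Subtype.val))` on the subtype `Fix` (an `A`-orbit through a fixed point consists of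
fixed points, `A ≤ C`).

* §1 (algebra) `smul_mem_fixedBy_of_mem_centralizer`, `mk_inv_out_mem_fixedBy_iff`, **`natCard_quotient_orbitRel_fixedBy_eq_sum_relIndex`** — the displayed count
  (hypotheses: `S_x ≤ C₀`, `[C₀ : S_x] ≠ 0` for all `x`; `C = A · C₀`, `A ∩ C₀ = 1`; any finite `s` off which `q.out γ q.out⁻¹ ∉ K`).
* §2 (measure) **`orbitalIntegral_indicator_quotientMeasure_eq_mul_natCard_quotient_orbitRel`** and the CLASS reading
  **`classOrbitalIntegral_indicator_eq_mul_natCard_quotient_orbitRel`** (+ `ℂ` twin) for a canonical family on a commutative centraliser.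

## References
* [Laumon1995] G. Laumon, *Cohomology of Drinfeld Modular Varieties* I, Cambridge Stud. Adv. Math. 41 (1996), Lemma (5.3.2) p. 136.
* [Kottwitz1988] R. E. Kottwitz, *Tamagawa numbers*, Ann. of Math. 127 (1988), §2 Theorem 2.
* [Rogawski1990] J. D. Rogawski, *Automorphic Representations of Unitary Groups in Three Variables*, Ann. of Math. Stud. 123 (1990), §4.9 p. 54; §4.3 p. 43.
* [Serre1980Trees] J.-P. Serre, *Trees* (1980), II.1.1 (the split torus acts on its apartment by translations).
-/

set_option autoImplicit false

noncomputable section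

open MeasureTheory Measure Topology Filter Set
open scoped ENNReal NNReal Pointwise

namespace Literature.NumberTheory.Automorphic

open Literature.MeasureTheory.Group

/-! ## §1 Algebra: `Fix_γ(G ⧸ K) ≃ Σ_{q fixed} A × C₀ ∕ S_q`, hence `#(Fix ∕ A) = Σ_{q fixed} [C₀ : S_q]` -/

section Algebra

variable {G : Type*} [Group G] (γ : G) (K : Subgroup G)
  (C₀ A : Subgroup (Subgroup.centralizer ({γ} : Set G)))

/-- A centraliser element moves `γ`-fixed points of `G ⧸ K` to `γ`-fixed points: `γ · (c · y) = c · (γ · y)`. [cite: Laumon1995, Lemma (5.3.2) p. 136] -/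
theorem smul_mem_fixedBy_of_mem_centralizer (c : Subgroup.centralizer ({γ} : Set G)) {y : G ⧸ K} (hy : y ∈ MulAction.fixedBy (G ⧸ K) γ) :
    (c : G) • y ∈ MulAction.fixedBy (G ⧸ K) γ := by
  have hc : (c : G) * γ = γ * (c : G) := Subgroup.mem_centralizer_singleton_iff.1 c.2
  rw [MulAction.mem_fixedBy] at hy ⊢
  rw [smul_smul, ← hc, mul_smul, hy]

/-- `x⁻¹K` is a `γ`-fixed point iff `x γ x⁻¹ ∈ K` (★ `conj_mem_iff_smul_mk_eq`, set form). [cite: Laumon1995, Lemma (5.3.2) p. 136] -/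
theorem mk_inv_mem_fixedBy_iff (x : G) : ((x⁻¹ : G) : G ⧸ K) ∈ MulAction.fixedBy (G ⧸ K) γ ↔ x * γ * x⁻¹ ∈ K := by
  rw [MulAction.mem_fixedBy, conj_mem_iff_smul_mk_eq]

/-- The stabiliser in `C` of the point `x⁻¹K`: `c · x⁻¹K = x⁻¹K ↔ x c x⁻¹ ∈ K ↔ c ∈ S_x`. [cite: Laumon1995, Lemma (5.3.2) p. 136] -/
theorem smul_mk_inv_eq_iff_mem_subgroupOf_comap_conj (c : Subgroup.centralizer ({γ} : Set G)) (x : G) :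
    (c : G) • ((x⁻¹ : G) : G ⧸ K) = ((x⁻¹ : G) : G ⧸ K) ↔ c ∈ (K.comap (MulAut.conj x).toMonoidHom).subgroupOf (Subgroup.centralizer ({γ} : Set G)) := by
  rw [Subgroup.mem_subgroupOf, mem_comap_conj_iff, conj_mem_iff_smul_mk_eq]

/-- **`#(Fix_γ(G ⧸ K) ∕ A) = Σ_{q ∈ s, q.out γ q.out⁻¹ ∈ K} [C₀ : C_G(γ) ∩ q.out⁻¹ K q.out]`.**  For subgroups `C₀, A ≤ C = C_G(γ)` with `C = A · C₀`, `A ∩ C₀ = 1`, all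
stabilisers `S_x = C ∩ x⁻¹Kx ≤ C₀` of finite index, and any finite set `s` of classes of `K\G∕C` off which `q.out γ q.out⁻¹ ∉ K`: the number of `A`-orbits of `γ`-fixed
points of `G ⧸ K` is FINITE and is the sum of the indices (via the `A`-equivariant bijection `Fix ≃ Σ_q A × C₀∕S_{q.out}`; both conjuncts from the one
bijection). [cite: Laumon1995, Lemma (5.3.2) p. 136] [cite: Kottwitz1988, §2 Theorem 2] -/
theorem finite_and_natCard_quotient_orbitRel_fixedBy_eq_sum_relIndex
    (hle : ∀ x : G, (K.comap (MulAut.conj x).toMonoidHom).subgroupOf (Subgroup.centralizer ({γ} : Set G)) ≤ C₀)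
    (hidx : ∀ x : G, ((K.comap (MulAut.conj x).toMonoidHom).subgroupOf (Subgroup.centralizer ({γ} : Set G))).relIndex C₀ ≠ 0)
    (hprod : ∀ c : Subgroup.centralizer ({γ} : Set G), ∃ a ∈ A, ∃ c₀ ∈ C₀, c = a * c₀)
    (hdisj : ∀ a : Subgroup.centralizer ({γ} : Set G), a ∈ A → a ∈ C₀ → a = 1)
    (s : Finset (DoubleCoset.Quotient (K : Set G) (Subgroup.centralizer ({γ} : Set G) : Set G)))
    (hs : ∀ q, q ∉ s → q.out * γ * q.out⁻¹ ∉ K) :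
    Finite (Quotient ((MulAction.orbitRel A (G ⧸ K)).comap (Subtype.val : MulAction.fixedBy (G ⧸ K) γ → G ⧸ K))) ∧
    Nat.card (Quotient ((MulAction.orbitRel A (G ⧸ K)).comap (Subtype.val : MulAction.fixedBy (G ⧸ K) γ → G ⧸ K))) =
      ∑ q ∈ s, (K : Set G).indicator
        (fun _ => ((K.comap (MulAut.conj q.out).toMonoidHom).subgroupOf (Subgroup.centralizer ({γ} : Set G))).relIndex C₀) (q.out * γ * q.out⁻¹) := by
  classical
  -- notation: the stabilisers `S x = C ∩ x⁻¹Kx ≤ C`, the relation `R` («same `A`-orbit») on the fixed points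
  set S : G → Subgroup (Subgroup.centralizer ({γ} : Set G)) :=
    fun x => (K.comap (MulAut.conj x).toMonoidHom).subgroupOf (Subgroup.centralizer ({γ} : Set G)) with hSdef
  set R : Setoid (MulAction.fixedBy (G ⧸ K) γ) := (MulAction.orbitRel A (G ⧸ K)).comap Subtype.val with hRdef
  have hsm : ∀ (u v : G), u • ((v : G) : G ⧸ K) = ((u * v : G) : G ⧸ K) := fun u v => rfl
  have hR : ∀ y y' : MulAction.fixedBy (G ⧸ K) γ,
      R y y' ↔ ∃ a : A, (((a : Subgroup.centralizer ({γ} : Set G)) : G)) • (y' : G ⧸ K) = (y : G ⧸ K) := fun y y' => by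
    rw [hRdef, Setoid.comap_rel, MulAction.orbitRel_apply, MulAction.mem_orbit_iff]
    rfl
  have hSz : ∀ (x : G) (c : Subgroup.centralizer ({γ} : Set G)), c ∈ S x ↔ (c : G) • ((x⁻¹ : G) : G ⧸ K) = ((x⁻¹ : G) : G ⧸ K) :=
    fun x c => (smul_mk_inv_eq_iff_mem_subgroupOf_comap_conj γ K c x).symm
  -- the contributing classes `s' = {q ∈ s | q.out γ q.out⁻¹ ∈ K}` (= ALL classes with that property, by `hs`)
  set s' := s.filter (fun q => q.out * γ * q.out⁻¹ ∈ K) with hs'def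
  have hmem_s' : ∀ q : DoubleCoset.Quotient (K : Set G) (Subgroup.centralizer ({γ} : Set G) : Set G), q.out * γ * q.out⁻¹ ∈ K → q ∈ s' := fun q hq => by
    rw [hs'def, Finset.mem_filter]
    exact ⟨by_contra fun h => hs q h hq, hq⟩
  have hout_s' : ∀ q : s', (q : DoubleCoset.Quotient (K : Set G) (Subgroup.centralizer ({γ} : Set G) : Set G)).out * γ * (q : DoubleCoset.Quotient (K : Set G) (Subgroup.centralizer ({γ} : Set G) : Set G)).out⁻¹ ∈ K := fun q => (Finset.mem_filter.1 q.2).2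
  -- the model `T = Σ_{q ∈ s'} C₀ ∕ S_{q.out}` and its cardinality
  haveI hfin : ∀ q : s', Fintype (C₀ ⧸ (S (q : DoubleCoset.Quotient (K : Set G) (Subgroup.centralizer ({γ} : Set G) : Set G)).out).subgroupOf C₀) := fun q => Subgroup.fintypeOfIndexNeZero (hidx _)
  have hcardT : Nat.card (Σ q : s', C₀ ⧸ (S (q : DoubleCoset.Quotient (K : Set G) (Subgroup.centralizer ({γ} : Set G) : Set G)).out).subgroupOf C₀) =
      ∑ q ∈ s, (K : Set G).indicator (fun _ => (S q.out).relIndex C₀) (q.out * γ * q.out⁻¹) := by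
    rw [Nat.card_sigma]
    have h1 : ∀ q : s', Nat.card (C₀ ⧸ (S (q : DoubleCoset.Quotient (K : Set G) (Subgroup.centralizer ({γ} : Set G) : Set G)).out).subgroupOf C₀) = (S (q : DoubleCoset.Quotient (K : Set G) (Subgroup.centralizer ({γ} : Set G) : Set G)).out).relIndex C₀ := fun q => rfl
    simp_rw [h1]
    rw [Finset.sum_coe_sort s' (fun q => (S q.out).relIndex C₀), hs'def, Finset.sum_filter]
    refine Finset.sum_congr rfl fun q _ => ?_
    by_cases hq : q.out * γ * q.out⁻¹ ∈ K
    · rw [if_pos hq, Set.indicator_of_mem (show q.out * γ * q.out⁻¹ ∈ (K : Set G) from hq)]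
    · rw [if_neg hq, Set.indicator_of_notMem (show q.out * γ * q.out⁻¹ ∉ (K : Set G) from hq)]
  -- the comparison map `ψ : T → Fix`, `(q, c₀ S) ↦ c₀ · q.out⁻¹K` (a representative `c₀` of the coset is CHOSEN; the `A`-class does not depend on it)
  let ψ : (Σ q : s', C₀ ⧸ (S (q : DoubleCoset.Quotient (K : Set G) (Subgroup.centralizer ({γ} : Set G) : Set G)).out).subgroupOf C₀) → MulAction.fixedBy (G ⧸ K) γ :=
    fun p => ⟨(((p.2.out : C₀) : Subgroup.centralizer ({γ} : Set G)) : G) • (((p.1 : DoubleCoset.Quotient (K : Set G) (Subgroup.centralizer ({γ} : Set G) : Set G)).out⁻¹ : G) : G ⧸ K),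
      smul_mem_fixedBy_of_mem_centralizer γ K _ ((mk_inv_mem_fixedBy_iff γ K _).2 (hout_s' p.1))⟩
  have hψ : ∀ (q : s') (c : C₀ ⧸ (S (q : DoubleCoset.Quotient (K : Set G) (Subgroup.centralizer ({γ} : Set G) : Set G)).out).subgroupOf C₀), ((ψ ⟨q, c⟩ : MulAction.fixedBy (G ⧸ K) γ) : G ⧸ K) =
      (((c.out : C₀) : Subgroup.centralizer ({γ} : Set G)) : G) • (((q : DoubleCoset.Quotient (K : Set G) (Subgroup.centralizer ({γ} : Set G) : Set G)).out⁻¹ : G) : G ⧸ K) := fun _ _ => rfl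
  -- KEY 1: two model points are `A`-related only if they are equal
  have hinj : ∀ p p', R (ψ p) (ψ p') → p = p' := by
    rintro ⟨q, c⟩ ⟨q', c'⟩ hrel
    obtain ⟨a, ha⟩ := (hR _ _).1 hrel
    rw [hψ, hψ] at ha
    -- `a c₀' · x'⁻¹K = c₀ · x⁻¹K` ⇒ `x' ∈ K x C` ⇒ `q = q'`
    have hKrel : (((a : Subgroup.centralizer ({γ} : Set G)) : G) * (((c'.out : C₀) : Subgroup.centralizer ({γ} : Set G)) : G) * (q' : DoubleCoset.Quotient (K : Set G) (Subgroup.centralizer ({γ} : Set G) : Set G)).out⁻¹)⁻¹ *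
        ((((c.out : C₀) : Subgroup.centralizer ({γ} : Set G)) : G) * (q : DoubleCoset.Quotient (K : Set G) (Subgroup.centralizer ({γ} : Set G) : Set G)).out⁻¹) ∈ K := by
      rw [← QuotientGroup.eq, ← hsm, ← hsm, mul_smul]
      exact ha
    have hqq : (q : DoubleCoset.Quotient (K : Set G) (Subgroup.centralizer ({γ} : Set G) : Set G)) = q' := by
      rw [← DoubleCoset.out_eq' K (Subgroup.centralizer ({γ} : Set G)) (q : DoubleCoset.Quotient (K : Set G) (Subgroup.centralizer ({γ} : Set G) : Set G)),
        ← DoubleCoset.out_eq' K (Subgroup.centralizer ({γ} : Set G)) (q' : DoubleCoset.Quotient (K : Set G) (Subgroup.centralizer ({γ} : Set G) : Set G)), DoubleCoset.eq]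
      refine ⟨(((a : Subgroup.centralizer ({γ} : Set G)) : G) * (((c'.out : C₀) : Subgroup.centralizer ({γ} : Set G)) : G) * (q' : DoubleCoset.Quotient (K : Set G) (Subgroup.centralizer ({γ} : Set G) : Set G)).out⁻¹)⁻¹ *
          ((((c.out : C₀) : Subgroup.centralizer ({γ} : Set G)) : G) * (q : DoubleCoset.Quotient (K : Set G) (Subgroup.centralizer ({γ} : Set G) : Set G)).out⁻¹), hKrel,
        ((((c.out : C₀) : Subgroup.centralizer ({γ} : Set G)) : G))⁻¹ *
          (((a : Subgroup.centralizer ({γ} : Set G)) : G) * (((c'.out : C₀) : Subgroup.centralizer ({γ} : Set G)) : G)), ?_, ?_⟩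
      · exact (Subgroup.centralizer ({γ} : Set G)).mul_mem ((Subgroup.centralizer ({γ} : Set G)).inv_mem ((c.out : C₀) : Subgroup.centralizer ({γ} : Set G)).2)
          ((Subgroup.centralizer ({γ} : Set G)).mul_mem (a : Subgroup.centralizer ({γ} : Set G)).2 ((c'.out : C₀) : Subgroup.centralizer ({γ} : Set G)).2)
      · group
    obtain rfl : q = q' := Subtype.ext hqq
    -- same class: `(c₀⁻¹ a c₀') · z = z` ⇒ `c₀⁻¹ a c₀' ∈ S_x ≤ C₀` ⇒ `a ∈ C₀` ⇒ `a = 1` ⇒ `c₀⁻¹ c₀' ∈ S_x` ⇒ `c = c'`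
    have hstab : ((c.out : C₀) : Subgroup.centralizer ({γ} : Set G))⁻¹ *
        ((a : Subgroup.centralizer ({γ} : Set G)) * ((c'.out : C₀) : Subgroup.centralizer ({γ} : Set G))) ∈ S (q : DoubleCoset.Quotient (K : Set G) (Subgroup.centralizer ({γ} : Set G) : Set G)).out := by
      rw [hSz, Subgroup.coe_mul, Subgroup.coe_mul, Subgroup.coe_inv, mul_smul, inv_smul_eq_iff, mul_smul]
      exact ha
    have haC₀ : (a : Subgroup.centralizer ({γ} : Set G)) ∈ C₀ := by
      have h := hle _ hstab
      have h2 : ((c.out : C₀) : Subgroup.centralizer ({γ} : Set G)) *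
          (((c.out : C₀) : Subgroup.centralizer ({γ} : Set G))⁻¹ *
            ((a : Subgroup.centralizer ({γ} : Set G)) * ((c'.out : C₀) : Subgroup.centralizer ({γ} : Set G)))) *
          ((c'.out : C₀) : Subgroup.centralizer ({γ} : Set G))⁻¹ ∈ C₀ :=
        C₀.mul_mem (C₀.mul_mem (c.out : C₀).2 h) (C₀.inv_mem (c'.out : C₀).2)
      simpa only [mul_inv_cancel_left, mul_inv_cancel_right] using h2
    have ha1 : (a : Subgroup.centralizer ({γ} : Set G)) = 1 := hdisj _ a.2 haC₀
    rw [ha1, one_mul] at hstab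
    have hcc : c = c' := by
      rw [← QuotientGroup.out_eq' c, ← QuotientGroup.out_eq' c', QuotientGroup.eq, Subgroup.mem_subgroupOf]
      simpa only [Subgroup.coe_mul, Subgroup.coe_inv] using hstab
    exact congrArg (Sigma.mk q) hcc
  -- KEY 2: every fixed point is `A`-related to a model point
  have hsurj : ∀ y : MulAction.fixedBy (G ⧸ K) γ, ∃ p, R (ψ p) y := by
    intro y
    obtain ⟨g, hg⟩ := QuotientGroup.mk_surjective (y : G ⧸ K)
    have hy : ((g : G) : G ⧸ K) ∈ MulAction.fixedBy (G ⧸ K) γ := by rw [hg]; exact y.2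
    -- the class `q₀ = K g⁻¹ C` contributes: `q₀.out = k g⁻¹ c`, `q₀.out γ q₀.out⁻¹ = k (g⁻¹ γ g) k⁻¹ ∈ K`
    have hgK : g⁻¹ * γ * g⁻¹⁻¹ ∈ K := (mk_inv_mem_fixedBy_iff γ K g⁻¹).1 (by rwa [inv_inv])
    obtain ⟨k, c, hk, hc, hout⟩ := DoubleCoset.mk_out_eq_mul K (Subgroup.centralizer ({γ} : Set G)) g⁻¹
    set q₀ : DoubleCoset.Quotient (K : Set G) (Subgroup.centralizer ({γ} : Set G) : Set G) := DoubleCoset.mk K (Subgroup.centralizer ({γ} : Set G)) g⁻¹ with hq₀def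
    have hcγ : c * γ = γ * c := Subgroup.mem_centralizer_singleton_iff.1 hc
    have hq₀K : q₀.out * γ * q₀.out⁻¹ ∈ K := by
      rw [hout]
      have h : k * g⁻¹ * c * γ * (k * g⁻¹ * c)⁻¹ = k * (g⁻¹ * γ * g⁻¹⁻¹) * k⁻¹ := by
        rw [show k * g⁻¹ * c * γ = k * g⁻¹ * (c * γ) by group, hcγ]; group
      rw [h]
      exact K.mul_mem (K.mul_mem hk hgK) (K.inv_mem hk)
    -- `g K = c · q₀.out⁻¹K`, `c = a c₀`, and the model point is `c₀ · q₀.out⁻¹K` (its chosen representative `c₀ h`, `h ∈ S`, acts like `c₀`)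
    have hgz : ((g : G) : G ⧸ K) = c • ((q₀.out⁻¹ : G) : G ⧸ K) := by
      rw [hsm, QuotientGroup.eq, hout]
      have h : g⁻¹ * (c * (k * g⁻¹ * c)⁻¹) = k⁻¹ := by group
      rw [h]
      exact K.inv_mem hk
    obtain ⟨a, ha, c₀, hc₀, hac⟩ := hprod ⟨c, hc⟩
    have hcG : c = ((a : Subgroup.centralizer ({γ} : Set G)) : G) * ((c₀ : Subgroup.centralizer ({γ} : Set G)) : G) := by
      have := congrArg (fun t : Subgroup.centralizer ({γ} : Set G) => (t : G)) hac
      simpa only [Subgroup.coe_mul] using this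
    obtain ⟨h, hh⟩ := QuotientGroup.mk_out_eq_mul (s := (S q₀.out).subgroupOf C₀) (⟨c₀, hc₀⟩ : C₀)
    have hhz : (((h : C₀) : Subgroup.centralizer ({γ} : Set G)) : G) • ((q₀.out⁻¹ : G) : G ⧸ K) = ((q₀.out⁻¹ : G) : G ⧸ K) :=
      (hSz q₀.out _).1 (Subgroup.mem_subgroupOf.1 h.2)
    refine ⟨⟨⟨q₀, hmem_s' q₀ hq₀K⟩, ((⟨c₀, hc₀⟩ : C₀) : C₀ ⧸ (S q₀.out).subgroupOf C₀)⟩, (hR _ _).2 ⟨(⟨a, ha⟩ : A)⁻¹, ?_⟩⟩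
    rw [← hg, hψ, hh, Subgroup.coe_mul, Subgroup.coe_mul, mul_smul, hhz, hgz, hcG, mul_smul, Subgroup.coe_inv, Subgroup.coe_inv, inv_smul_smul]
  -- conclusion: `T ≃ Fix ∕ A`
  have hbij : Function.Bijective (fun p : (Σ q : s', C₀ ⧸ (S (q : DoubleCoset.Quotient (K : Set G) (Subgroup.centralizer ({γ} : Set G) : Set G)).out).subgroupOf C₀) => Quotient.mk R (ψ p)) := by
    refine ⟨fun p p' h => hinj p p' (Quotient.exact h), fun Y => ?_⟩
    induction Y using Quotient.inductionOn with
    | h y =>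
      obtain ⟨p, hp⟩ := hsurj y
      exact ⟨p, Quotient.sound hp⟩
  refine ⟨Finite.of_surjective _ hbij.2, ?_⟩
  rw [← Nat.card_eq_of_bijective _ hbij, hcardT]

/-- **`Fix_γ(G ⧸ K) ∕ A` IS FINITE** (finitely many contributing classes, each with finitely many `A`-orbits). [cite: Laumon1995, Lemma (5.3.2) p. 136] -/
theorem finite_quotient_orbitRel_fixedBy
    (hle : ∀ x : G, (K.comap (MulAut.conj x).toMonoidHom).subgroupOf (Subgroup.centralizer ({γ} : Set G)) ≤ C₀)
    (hidx : ∀ x : G, ((K.comap (MulAut.conj x).toMonoidHom).subgroupOf (Subgroup.centralizer ({γ} : Set G))).relIndex C₀ ≠ 0)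
    (hprod : ∀ c : Subgroup.centralizer ({γ} : Set G), ∃ a ∈ A, ∃ c₀ ∈ C₀, c = a * c₀)
    (hdisj : ∀ a : Subgroup.centralizer ({γ} : Set G), a ∈ A → a ∈ C₀ → a = 1)
    (s : Finset (DoubleCoset.Quotient (K : Set G) (Subgroup.centralizer ({γ} : Set G) : Set G)))
    (hs : ∀ q, q ∉ s → q.out * γ * q.out⁻¹ ∉ K) :
    Finite (Quotient ((MulAction.orbitRel A (G ⧸ K)).comap (Subtype.val : MulAction.fixedBy (G ⧸ K) γ → G ⧸ K))) :=
  (finite_and_natCard_quotient_orbitRel_fixedBy_eq_sum_relIndex γ K C₀ A hle hidx hprod hdisj s hs).1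

/-- **`#(Fix_γ(G ⧸ K) ∕ A) = Σ_{q ∈ s, q.out γ q.out⁻¹ ∈ K} [C₀ : C_G(γ) ∩ q.out⁻¹ K q.out]`** — the count alone. [cite: Laumon1995, Lemma (5.3.2) p. 136] [cite: Kottwitz1988, §2 Theorem 2] -/
theorem natCard_quotient_orbitRel_fixedBy_eq_sum_relIndex
    (hle : ∀ x : G, (K.comap (MulAut.conj x).toMonoidHom).subgroupOf (Subgroup.centralizer ({γ} : Set G)) ≤ C₀)
    (hidx : ∀ x : G, ((K.comap (MulAut.conj x).toMonoidHom).subgroupOf (Subgroup.centralizer ({γ} : Set G))).relIndex C₀ ≠ 0)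
    (hprod : ∀ c : Subgroup.centralizer ({γ} : Set G), ∃ a ∈ A, ∃ c₀ ∈ C₀, c = a * c₀)
    (hdisj : ∀ a : Subgroup.centralizer ({γ} : Set G), a ∈ A → a ∈ C₀ → a = 1)
    (s : Finset (DoubleCoset.Quotient (K : Set G) (Subgroup.centralizer ({γ} : Set G) : Set G)))
    (hs : ∀ q, q ∉ s → q.out * γ * q.out⁻¹ ∉ K) :
    Nat.card (Quotient ((MulAction.orbitRel A (G ⧸ K)).comap (Subtype.val : MulAction.fixedBy (G ⧸ K) γ → G ⧸ K))) =
      ∑ q ∈ s, (K : Set G).indicator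
        (fun _ => ((K.comap (MulAut.conj q.out).toMonoidHom).subgroupOf (Subgroup.centralizer ({γ} : Set G))).relIndex C₀) (q.out * γ * q.out⁻¹) :=
  (finite_and_natCard_quotient_orbitRel_fixedBy_eq_sum_relIndex γ K C₀ A hle hidx hprod hdisj s hs).2

end Algebra

/-! ## §2 The measure dress: `O_γ(1_K) = ν(K) · #(Fix_γ(G ⧸ K) ∕ A)` -/

section Orbital

variable {G : Type*} [Group G] [TopologicalSpace G] [IsTopologicalGroup G] [LocallyCompactSpace G]
  [SecondCountableTopology G] [T2Space G] [MeasurableSpace G] [BorelSpace G]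
  (γ : G) (K : Subgroup G) (C₀ A : Subgroup (Subgroup.centralizer ({γ} : Set G)))
  [MeasurableSpace (G ⧸ Subgroup.centralizer ({γ} : Set G))]
  [BorelSpace (G ⧸ Subgroup.centralizer ({γ} : Set G))]
  [hC : IsClosed ((Subgroup.centralizer ({γ} : Set G) : Subgroup G) : Set G)]
  (t : Measure (Subgroup.centralizer ({γ} : Set G))) [t.IsMulLeftInvariant]
  [IsFiniteMeasureOnCompacts t] [t.IsOpenPosMeasure] [t.IsInvInvariant] [SFinite t]
  (ν : Measure G) [IsHaarMeasure ν] [ν.IsMulRightInvariant]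

omit [TopologicalSpace G] [IsTopologicalGroup G] [LocallyCompactSpace G] [SecondCountableTopology G] [T2Space G] [MeasurableSpace G] [BorelSpace G]
  [MeasurableSpace (G ⧸ Subgroup.centralizer ({γ} : Set G))] [BorelSpace (G ⧸ Subgroup.centralizer ({γ} : Set G))] hC in
/-- Cast of the counting sum: `Σ_q 1_K(·) · [C₀ : S_q]` read in `ℝ`. [cite: Laumon1995, Lemma (5.3.2) p. 136] -/
theorem cast_sum_indicator_relIndex (s : Finset (DoubleCoset.Quotient (K : Set G) (Subgroup.centralizer ({γ} : Set G) : Set G))) :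
    ((∑ q ∈ s, (K : Set G).indicator
        (fun _ => ((K.comap (MulAut.conj q.out).toMonoidHom).subgroupOf (Subgroup.centralizer ({γ} : Set G))).relIndex C₀) (q.out * γ * q.out⁻¹) : ℕ) : ℝ) =
      ∑ q ∈ s, (K : Set G).indicator (1 : G → ℝ) (q.out * γ * q.out⁻¹) *
        ((((K.comap (MulAut.conj q.out).toMonoidHom).subgroupOf (Subgroup.centralizer ({γ} : Set G))).relIndex C₀ : ℕ) : ℝ) := by
  rw [Nat.cast_sum]
  refine Finset.sum_congr rfl fun q _ => ?_
  by_cases hq : q.out * γ * q.out⁻¹ ∈ K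
  · rw [Set.indicator_of_mem (show q.out * γ * q.out⁻¹ ∈ (K : Set G) from hq), Set.indicator_of_mem (show q.out * γ * q.out⁻¹ ∈ (K : Set G) from hq),
      Pi.one_apply, one_mul]
  · rw [Set.indicator_of_notMem (show q.out * γ * q.out⁻¹ ∉ (K : Set G) from hq),
      Set.indicator_of_notMem (show q.out * γ * q.out⁻¹ ∉ (K : Set G) from hq), Nat.cast_zero, zero_mul]

/-- **THE UNIT ORBITAL INTEGRAL IS `ν(K)` TIMES THE NUMBER OF `γ`-FIXED POINTS OF `G ⧸ K` PER PERIOD.**  `K` compact open, the class of `γ` closed, `C₀ ≤ C_G(γ)` compact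
open containing the compact core (so `C₀` IS the compact core), `A ≤ C_G(γ)` a complement (`C_G(γ) = A · C₀`, `A ∩ C₀ = 1` — e.g. `ϖ^ℤ` in `L_w^× = ϖ^ℤ × 𝒪_w^×`), `t`
left-invariant on `C_G(γ)` with `t(C₀) = 1`, `ν` Haar on `G`:
`O_γ^{ν∕t}(1_K) = ν(K) · #(Fix_γ(G ⧸ K) ∕ A)`, the number of `A`-orbits of `γ`-fixed points. [cite: Laumon1995, Lemma (5.3.2) p. 136] [cite: Kottwitz1988, §2 Theorem 2]
[cite: Rogawski1990, §4.9 p. 54; §4.3 p. 43] -/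
theorem orbitalIntegral_indicator_quotientMeasure_eq_mul_natCard_quotient_orbitRel (hO : IsClosed {g | ∃ y : G, y * γ * y⁻¹ = g})
    (hK : IsOpen (K : Set G)) (hKc : IsCompact (K : Set G))
    (hC₀c : IsCompact (C₀ : Set (Subgroup.centralizer ({γ} : Set G)))) (hC₀o : IsOpen (C₀ : Set (Subgroup.centralizer ({γ} : Set G))))
    (hcore : compactCore (Subgroup.centralizer ({γ} : Set G)) ⊆ C₀) (ht : t C₀ = 1)
    (hprod : ∀ c : Subgroup.centralizer ({γ} : Set G), ∃ a ∈ A, ∃ c₀ ∈ C₀, c = a * c₀)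
    (hdisj : ∀ a : Subgroup.centralizer ({γ} : Set G), a ∈ A → a ∈ C₀ → a = 1) :
    orbitalIntegral γ ((K : Set G).indicator (1 : G → ℝ)) (quotientMeasure (Subgroup.centralizer ({γ} : Set G)) t hC ν) =
      (ν K).toReal * Nat.card (Quotient ((MulAction.orbitRel A (G ⧸ K)).comap (Subtype.val : MulAction.fixedBy (G ⧸ K) γ → G ⧸ K))) := by
  -- the contributing classes are finitely many at a closed class (★ `finite_setOf_conj_out_ne_zero_of_isClosed` on `1_K`)
  have hclopen : IsClopen (K : Set G) := ⟨Subgroup.isClosed_of_isOpen K hK, hK⟩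
  have hfs : HasCompactSupport ((K : Set G).indicator (1 : G → ℝ)) := HasCompactSupport.intro hKc fun g hg => Set.indicator_of_notMem hg _
  have hfin := finite_setOf_conj_out_ne_zero_of_isClosed γ K hO hK hfs
  have hs : ∀ q, q ∉ hfin.toFinset → q.out * γ * q.out⁻¹ ∉ K := by
    intro q hq hqK
    apply hq
    rw [Set.Finite.mem_toFinset, Set.mem_setOf_eq, Set.indicator_of_mem (show q.out * γ * q.out⁻¹ ∈ (K : Set G) from hqK), Pi.one_apply]
    exact one_ne_zero
  rw [orbitalIntegral_indicator_quotientMeasure_eq_mul_sum_relIndex γ K C₀ t ν hO hK hKc hC₀c hC₀o hcore ht hfin.toFinset hs,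
    natCard_quotient_orbitRel_fixedBy_eq_sum_relIndex γ K C₀ A (subgroupOf_comap_conj_le_of_compactCore_subset γ K C₀ hKc hcore)
      (relIndex_subgroupOf_comap_conj_ne_zero γ K C₀ hK hC₀c) hprod hdisj hfin.toFinset hs,
    cast_sum_indicator_relIndex γ K C₀]

omit [MeasurableSpace G] [BorelSpace G]
  [MeasurableSpace (G ⧸ Subgroup.centralizer ({γ} : Set G))] [BorelSpace (G ⧸ Subgroup.centralizer ({γ} : Set G))] hC in
/-- **`Fix_γ(G ⧸ K) ∕ A` is finite** at a closed class for `K` compact open and `C₀` compact open ⊇ compact core with a complement `A`. [cite: Laumon1995, Lemma (5.3.2) p. 136] -/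
theorem finite_quotient_orbitRel_fixedBy_of_isClosed (hO : IsClosed {g | ∃ y : G, y * γ * y⁻¹ = g})
    (hK : IsOpen (K : Set G)) (hKc : IsCompact (K : Set G))
    (hC₀c : IsCompact (C₀ : Set (Subgroup.centralizer ({γ} : Set G))))
    (hcore : compactCore (Subgroup.centralizer ({γ} : Set G)) ⊆ C₀)
    (hprod : ∀ c : Subgroup.centralizer ({γ} : Set G), ∃ a ∈ A, ∃ c₀ ∈ C₀, c = a * c₀)
    (hdisj : ∀ a : Subgroup.centralizer ({γ} : Set G), a ∈ A → a ∈ C₀ → a = 1) :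
    Finite (Quotient ((MulAction.orbitRel A (G ⧸ K)).comap (Subtype.val : MulAction.fixedBy (G ⧸ K) γ → G ⧸ K))) := by
  have hclopen : IsClopen (K : Set G) := ⟨Subgroup.isClosed_of_isOpen K hK, hK⟩
  have hfs : HasCompactSupport ((K : Set G).indicator (1 : G → ℝ)) := HasCompactSupport.intro hKc fun g hg => Set.indicator_of_notMem hg _
  have hfin := finite_setOf_conj_out_ne_zero_of_isClosed γ K hO hK hfs
  have hs : ∀ q, q ∉ hfin.toFinset → q.out * γ * q.out⁻¹ ∉ K := by
    intro q hq hqK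
    apply hq
    rw [Set.Finite.mem_toFinset, Set.mem_setOf_eq, Set.indicator_of_mem (show q.out * γ * q.out⁻¹ ∈ (K : Set G) from hqK), Pi.one_apply]
    exact one_ne_zero
  exact finite_quotient_orbitRel_fixedBy γ K C₀ A (subgroupOf_comap_conj_le_of_compactCore_subset γ K C₀ hKc hcore)
    (relIndex_subgroupOf_comap_conj_ne_zero γ K C₀ hK hC₀c) hprod hdisj hfin.toFinset hs

end Orbital

/-! ## §3 The class reading for a canonical family (commutative centraliser) -/

section Canonical

variable {G : Type*} [Group G] [TopologicalSpace G] [IsTopologicalGroup G] [LocallyCompactSpace G]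
  [SecondCountableTopology G] [T2Space G] [MeasurableSpace G] [BorelSpace G]
  [∀ γ : G, MeasurableSpace (G ⧸ Subgroup.centralizer ({γ} : Set G))]
  [∀ γ : G, BorelSpace (G ⧸ Subgroup.centralizer ({γ} : Set G))]

/-- **THE CLASS READING PER PERIOD, intrinsic form: `classOrbitalIntegral m 1_K ⟦γ⟧ = ν(K) · #(Fix_γ(G ⧸ K) ∕ A)`** for a family `m` CANONICAL for `(P, ν)`, `P`
conjugation-invariant with `P γ`, the class of `γ` closed, `K` compact open, `C_G(γ)` COMMUTATIVE with compact core inside the compact open `C₀` and complement `A`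
(`C_G(γ) = A · C₀`, `A ∩ C₀ = 1`).  The (N)-side currency of the Euler–Poincaré glue ★ p842588: each `ν(C)⁻¹Φ(⟦γ⟧, 1_C)` is a count of fixed facets per period.
[cite: Laumon1995, Lemma (5.3.2) p. 136] [cite: Kottwitz1988, §2 Theorem 2] [cite: Rogawski1990, §4.9 p. 54; §4.3 p. 43] -/
theorem classOrbitalIntegral_indicator_eq_mul_natCard_quotient_orbitRel {P : G → Prop} (hP : ∀ g x : G, P g → P (x * g * x⁻¹))
    {ν : Measure G} [ν.IsHaarMeasure] [ν.IsMulRightInvariant] {m : OrbitalMeasureFamily G} (hm : m.IsCanonical P ν)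
    {γ : G} (hγ : P γ) (hcomm : ∀ a b : Subgroup.centralizer ({γ} : Set G), a * b = b * a)
    (C₀ A : Subgroup (Subgroup.centralizer ({γ} : Set G))) (hC₀c : IsCompact (C₀ : Set (Subgroup.centralizer ({γ} : Set G))))
    (hC₀o : IsOpen (C₀ : Set (Subgroup.centralizer ({γ} : Set G)))) (hcore : compactCore (Subgroup.centralizer ({γ} : Set G)) ⊆ C₀)
    (hprod : ∀ c : Subgroup.centralizer ({γ} : Set G), ∃ a ∈ A, ∃ c₀ ∈ C₀, c = a * c₀)
    (hdisj : ∀ a : Subgroup.centralizer ({γ} : Set G), a ∈ A → a ∈ C₀ → a = 1)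
    (K : Subgroup G) (hK : IsOpen (K : Set G)) (hKc : IsCompact (K : Set G)) (hO : IsClosed {g | ∃ y : G, y * γ * y⁻¹ = g}) :
    classOrbitalIntegral m ((K : Set G).indicator (1 : G → ℝ)) (ConjClasses.mk γ) =
      (ν K).toReal * Nat.card (Quotient ((MulAction.orbitRel A (G ⧸ K)).comap (Subtype.val : MulAction.fixedBy (G ⧸ K) γ → G ⧸ K))) := by
  haveI : BorelSpace (Subgroup.centralizer ({γ} : Set G)) := Subtype.borelSpace _
  haveI : LocallyCompactSpace (Subgroup.centralizer ({γ} : Set G)) :=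
    (isClosed_coe_centralizer_singleton γ).isClosedEmbedding_subtypeVal.locallyCompactSpace
  have hcc : compactCore (Subgroup.centralizer ({γ} : Set G)) = (C₀ : Set (Subgroup.centralizer ({γ} : Set G))) :=
    compactCore_eq_coe_of_subset γ C₀ hC₀c hcore
  obtain ⟨t, ht, hti, ht1⟩ := exists_isHaarMeasure_compactCore_eq_one hcomm (hcc ▸ hC₀c) (hcc ▸ hC₀o)
  haveI := ht
  haveI := hti
  haveI : IsClosed ((Subgroup.centralizer ({γ} : Set G) : Subgroup G) : Set G) := isClosed_coe_centralizer_singleton γ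
  have ht1' : t C₀ = 1 := by rw [← hcc]; exact ht1
  rw [hm.classOrbitalIntegral_mk_eq_orbitalIntegral' hP hγ t ht1]
  exact orbitalIntegral_indicator_quotientMeasure_eq_mul_natCard_quotient_orbitRel γ K C₀ A t ν hO hK hKc hC₀c hC₀o hcore ht1' hprod hdisj

/-- `ℂ`-valued twin (the letters' currency). [cite: Laumon1995, Lemma (5.3.2) p. 136] [cite: Rogawski1990, §4.9 p. 54] -/
theorem classOrbitalIntegral_indicator_complex_eq_mul_natCard_quotient_orbitRel {P : G → Prop} (hP : ∀ g x : G, P g → P (x * g * x⁻¹))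
    {ν : Measure G} [ν.IsHaarMeasure] [ν.IsMulRightInvariant] {m : OrbitalMeasureFamily G} (hm : m.IsCanonical P ν)
    {γ : G} (hγ : P γ) (hcomm : ∀ a b : Subgroup.centralizer ({γ} : Set G), a * b = b * a)
    (C₀ A : Subgroup (Subgroup.centralizer ({γ} : Set G))) (hC₀c : IsCompact (C₀ : Set (Subgroup.centralizer ({γ} : Set G))))
    (hC₀o : IsOpen (C₀ : Set (Subgroup.centralizer ({γ} : Set G)))) (hcore : compactCore (Subgroup.centralizer ({γ} : Set G)) ⊆ C₀)
    (hprod : ∀ c : Subgroup.centralizer ({γ} : Set G), ∃ a ∈ A, ∃ c₀ ∈ C₀, c = a * c₀)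
    (hdisj : ∀ a : Subgroup.centralizer ({γ} : Set G), a ∈ A → a ∈ C₀ → a = 1)
    (K : Subgroup G) (hK : IsOpen (K : Set G)) (hKc : IsCompact (K : Set G)) (hO : IsClosed {g | ∃ y : G, y * γ * y⁻¹ = g}) :
    classOrbitalIntegral m ((K : Set G).indicator fun _ => (1 : ℂ)) (ConjClasses.mk γ) =
      (((ν K).toReal : ℝ) : ℂ) * (Nat.card (Quotient ((MulAction.orbitRel A (G ⧸ K)).comap (Subtype.val : MulAction.fixedBy (G ⧸ K) γ → G ⧸ K))) : ℂ) := by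
  rw [classOrbitalIntegral_indicator_complex_eq_ofReal,
    classOrbitalIntegral_indicator_eq_mul_natCard_quotient_orbitRel hP hm hγ hcomm C₀ A hC₀c hC₀o hcore hprod hdisj K hK hKc hO]
  push_cast
  rfl

end Canonical

end Literature.NumberTheory.Automorphic

end
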